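import Mathlib.Geometry.Manifold.LocalDiffeomorph
import Mathlib.Geometry.Manifold.MFDeriv.Basic
import Mathlib.Geometry.Manifold.MFDeriv.SpecificFunctions
import Mathlib.Geometry.Manifold.Instances.Real
import Mathlib.Analysis.InnerProductSpace.PiL2
import Mathlib.Analysis.Complex.Basic

/-!
# The wedge coordinate `T` has nowhere vanishing differential
(registered helper `helper_wedgeCoordinateDerivNeZero` of line `cross-cap-laurent`, crux
`GromovRecognitionRelEnd`, item stmt-SmoothPoincare4-11009)

In the wedge cap `X` the sphere at infinity `H∞` is covered by the two cap charts
`ηH : D_H = {p 2² + p 3² < R₁⁻²} → X` and `ηC : D_C = {p 0² + p 1² < R₁⁻², p 2² + p 3² < R₁⁻²} → X`,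
both `C^∞` local diffeomorphisms on their (open) polydiscs, and the wedge coordinate `T : X → ℂ`
(`helper_wedgeCoordinateH`) is `C^∞` on the open set `U_H = ηH '' D_H ∪ ηC '' D_C` and reads
`T (ηH p) = p 2 + i p 3` on `D_H`, `T (ηC p) = p 2 + i p 3` on `D_C`.  This file proves that
`dT_y ≠ 0` at every `y ∈ U_H`.

Proof: write `y = η p` with `η ∈ {ηH, ηC}` and `p` in the corresponding open polydisc `D`.  On `D`
we have `T ∘ η = L`, where `L : ℝ⁴ →L[ℝ] ℂ`, `L p = p 2 + i p 3`, is a nonzero real continuous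
linear map, so `d(T ∘ η)_p = dL_p = L` (`Filter.EventuallyEq.mfderiv_eq`,
`ContinuousLinearMap.mfderiv_eq`).  By the chain rule (`mfderiv_comp`; `T` is differentiable at
`η p ∈ U_H` as `U_H` is open, `η` is differentiable at `p` as a local diffeomorphism)
`d(T ∘ η)_p = dT_{η p} ∘ dη_p`, which would vanish if `dT_{η p} = 0`; hence `dT_{η p} ≠ 0`.

Everything is proved; no definition, no named fact.

References: J. M. Lee, *Introduction to Smooth Manifolds*, 2nd ed. (2013), Prop. 3.6 (chain
rule) [LeeSmoothManifolds2013]; D. McDuff, D. Salamon, *Introduction to Symplectic Topology*,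
3rd ed. (2017), §2.5 [McDuffSalamon2017].
-/

-- the registered namespace `Summit.SmoothPoincare4.SmoothPoincare4.Theorems…` repeats a component
set_option linter.dupNamespace false

open scoped Manifold ContDiff Topology
open Set Function Filter

namespace Summit.SmoothPoincare4.SmoothPoincare4.Theorems.GromovRecognitionRelEnd.CrossCapLaurent

namespace WedgeCoordinateDerivNeZero

section General

variable {E : Type*} [NormedAddCommGroup E] [NormedSpace ℝ E]
  {F : Type*} [NormedAddCommGroup F] [NormedSpace ℝ F]
  {E' : Type*} [NormedAddCommGroup E'] [NormedSpace ℝ E'] {H' : Type*} [TopologicalSpace H']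
  {I' : ModelWithCorners ℝ E' H'} {X : Type*} [TopologicalSpace X] [ChartedSpace H' X]

/-- **A function reading a nonzero linear map through a local diffeomorphism has nonzero
differential.**  If `η : E → X` is a `C^∞` local diffeomorphism at a point `p` of an open set `D`,
`T : X → F` is differentiable at `η p`, and `T (η q) = L q` for all `q ∈ D` with `L : E →L[ℝ] F` a
nonzero continuous linear map, then `dT_{η p} ≠ 0`: by the chain rule
`dT_{η p} ∘ dη_p = d(T ∘ η)_p = dL_p = L ≠ 0`. [folklore] -/
theorem mfderiv_ne_zero_of_comp_eqOn {η : E → X} {D : Set E} (hD : IsOpen D) {p : E}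
    (hp : p ∈ D) (hη : IsLocalDiffeomorphAt 𝓘(ℝ, E) I' ∞ η p) {T : X → F}
    (hT : MDifferentiableAt I' 𝓘(ℝ, F) T (η p)) {L : E →L[ℝ] F}
    (hTL : ∀ q ∈ D, T (η q) = L q) (hL : L ≠ 0) :
    mfderiv I' 𝓘(ℝ, F) T (η p) ≠ 0 := by
  intro h0
  have hηd : MDifferentiableAt 𝓘(ℝ, E) I' η p := hη.mdifferentiableAt (by simp)
  -- `T ∘ η = L` near `p`
  have hE : (T ∘ η) =ᶠ[𝓝 p] (⇑L) := eventuallyEq_of_mem (hD.mem_nhds hp) fun q hq => hTL q hq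
  -- chain rule: `d(T ∘ η)_p = dT_{η p} ∘ dη_p = 0`
  have key : mfderiv 𝓘(ℝ, E) 𝓘(ℝ, F) (T ∘ η) p = 0 := by
    rw [mfderiv_comp p hT hηd, h0]
    exact ContinuousLinearMap.zero_comp _
  -- but `d(T ∘ η)_p = dL_p = L ≠ 0`
  rw [hE.mfderiv_eq, ContinuousLinearMap.mfderiv_eq] at key
  exact hL key

end General

/-- The second complex coordinate `p ↦ p 2 + i p 3` of `ℝ⁴ = ℂ²` is a real continuous linear map
`ℝ⁴ →L[ℝ] ℂ`. [folklore] -/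
theorem exists_clm_coord23 : ∃ L : EuclideanSpace ℝ (Fin 4) →L[ℝ] ℂ,
    ∀ p : EuclideanSpace ℝ (Fin 4), L p = ⟨p 2, p 3⟩ :=
  ⟨Complex.equivRealProdCLM.symm.toContinuousLinearMap.comp
      ((PiLp.proj 2 (fun _ : Fin 4 => ℝ) 2).prod (PiLp.proj 2 (fun _ : Fin 4 => ℝ) 3)),
    fun p => by apply Complex.ext <;> simp⟩

/-- The second complex coordinate `p ↦ p 2 + i p 3` of `ℝ⁴ = ℂ²` is a NONZERO real-linear map (it
sends `(0, 0, 1, 0)` to `1`). [folklore] -/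
theorem clm_coord23_ne_zero {L : EuclideanSpace ℝ (Fin 4) →L[ℝ] ℂ}
    (hL : ∀ p : EuclideanSpace ℝ (Fin 4), L p = ⟨p 2, p 3⟩) : L ≠ 0 := by
  intro h
  have h1 := congrArg
    (fun Φ : EuclideanSpace ℝ (Fin 4) →L[ℝ] ℂ => (Φ (WithLp.toLp 2 ![0, 0, 1, 0])).re) h
  simp [hL] at h1

end WedgeCoordinateDerivNeZero

open WedgeCoordinateDerivNeZero in
/-- **Registered helper `helper_wedgeCoordinateDerivNeZero`** (line `cross-cap-laurent`, signature
verbatim): the wedge coordinate `T : X → ℂ`, `C^∞` on the open set `U_H = ηH '' D_H ∪ ηC '' D_C`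
and reading `T (ηH p) = p 2 + i p 3` on `D_H`, `T (ηC p) = p 2 + i p 3` on `D_C` through the
`C^∞` local diffeomorphisms `ηH`, `ηC`, has nonzero differential `dT_y ≠ 0` at every `y ∈ U_H`.
See the file header for the (chain rule) proof. [folklore] -/
theorem helper_wedgeCoordinateDerivNeZero : ∀ (X : Type) [TopologicalSpace X] [T2Space X] [ChartedSpace (EuclideanSpace ℝ (Fin 4)) X] [IsManifold (𝓡 4) ∞ X] (R₁ : ℝ) (ηH ηC : EuclideanSpace ℝ (Fin 4) → X) (T : X → ℂ), 0 < R₁ → IsLocalDiffeomorphOn 𝓘(ℝ, EuclideanSpace ℝ (Fin 4)) (𝓡 4) ∞ ηH {p : EuclideanSpace ℝ (Fin 4) | p 2 ^ 2 + p 3 ^ 2 < R₁⁻¹ ^ 2} → IsLocalDiffeomorphOn 𝓘(ℝ, EuclideanSpace ℝ (Fin 4)) (𝓡 4) ∞ ηC {p : EuclideanSpace ℝ (Fin 4) | p 0 ^ 2 + p 1 ^ 2 < R₁⁻¹ ^ 2 ∧ p 2 ^ 2 + p 3 ^ 2 < R₁⁻¹ ^ 2} → IsOpen (ηH '' {p :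 EuclideanSpace ℝ (Fin 4) | p 2 ^ 2 + p 3 ^ 2 < R₁⁻¹ ^ 2} ∪ ηC '' {p : EuclideanSpace ℝ (Fin 4) | p 0 ^ 2 + p 1 ^ 2 < R₁⁻¹ ^ 2 ∧ p 2 ^ 2 + p 3 ^ 2 < R₁⁻¹ ^ 2}) → ContMDiffOn (𝓡 4) 𝓘(ℝ, ℂ) ∞ T (ηH '' {p : EuclideanSpace ℝ (Fin 4) | p 2 ^ 2 + p 3 ^ 2 < R₁⁻¹ ^ 2} ∪ ηC '' {p : EuclideanSpace ℝ (Fin 4) | p 0 ^ 2 + p 1 ^ 2 < R₁⁻¹ ^ 2 ∧ p 2 ^ 2 + p 3 ^ 2 < R₁⁻¹ ^ 2}) → (∀ p : EuclideanSpace ℝ (Fin 4), p 2 ^ 2 + p 3 ^ 2 < R₁⁻¹ ^ 2 → T (ηH p) = ⟨p 2, p 3⟩) → (∀ p : EuclideanSpace ℝ (Fin 4), p 0 ^ 2 + p 1 ^ 2 < R₁⁻¹ ^ 2 → p 2 ^ 2 + p 3 ^ 2 < R₁⁻¹ ^ 2 → T (ηC p) = ⟨p 2, p 3⟩) → ∀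 y ∈ (ηH '' {p : EuclideanSpace ℝ (Fin 4) | p 2 ^ 2 + p 3 ^ 2 < R₁⁻¹ ^ 2} ∪ ηC '' {p : EuclideanSpace ℝ (Fin 4) | p 0 ^ 2 + p 1 ^ 2 < R₁⁻¹ ^ 2 ∧ p 2 ^ 2 + p 3 ^ 2 < R₁⁻¹ ^ 2}), mfderiv (𝓡 4) 𝓘(ℝ, ℂ) T y ≠ 0 := by
  intro X _ _ _ _ R₁ ηH ηC T _ hHloc hCloc hUo hTsm hTH hTC y hy
  -- the two coordinate polydiscs are open
  set DH : Set (EuclideanSpace ℝ (Fin 4)) :=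
    {p : EuclideanSpace ℝ (Fin 4) | p 2 ^ 2 + p 3 ^ 2 < R₁⁻¹ ^ 2} with hDH
  set DC : Set (EuclideanSpace ℝ (Fin 4)) :=
    {p : EuclideanSpace ℝ (Fin 4) | p 0 ^ 2 + p 1 ^ 2 < R₁⁻¹ ^ 2 ∧ p 2 ^ 2 + p 3 ^ 2 < R₁⁻¹ ^ 2}
    with hDC
  have hc : ∀ i : Fin 4, Continuous fun p : EuclideanSpace ℝ (Fin 4) => p i := fun i =>
    (continuous_apply i).comp (PiLp.continuous_ofLp 2 _)
  have hr1 : Continuous fun p : EuclideanSpace ℝ (Fin 4) => p 0 ^ 2 + p 1 ^ 2 :=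
    ((hc 0).pow 2).add ((hc 1).pow 2)
  have hr2 : Continuous fun p : EuclideanSpace ℝ (Fin 4) => p 2 ^ 2 + p 3 ^ 2 :=
    ((hc 2).pow 2).add ((hc 3).pow 2)
  have hDHo : IsOpen DH := isOpen_lt hr2 continuous_const
  have hDCo : IsOpen DC := (isOpen_lt hr1 continuous_const).and (isOpen_lt hr2 continuous_const)
  -- the second complex coordinate as a nonzero real continuous linear map `ℝ⁴ →L[ℝ] ℂ`
  obtain ⟨L, hL⟩ := exists_clm_coord23
  have hL0 : L ≠ 0 := clm_coord23_ne_zero hL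
  -- `T` is differentiable at every point of the open set `U_H`
  have hTd : ∀ z ∈ ηH '' DH ∪ ηC '' DC, MDifferentiableAt (𝓡 4) 𝓘(ℝ, ℂ) T z := fun z hz =>
    (hTsm.contMDiffAt (hUo.mem_nhds hz)).mdifferentiableAt (by simp)
  rcases hy with ⟨p, hp, rfl⟩ | ⟨p, hp, rfl⟩
  · -- `y = ηH p`, `p ∈ D_H`: `T ∘ ηH = L` on `D_H`
    exact mfderiv_ne_zero_of_comp_eqOn hDHo hp (hHloc ⟨p, hp⟩) (hTd _ (Or.inl ⟨p, hp, rfl⟩))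
      (fun q hq => (hTH q hq).trans (hL q).symm) hL0
  · -- `y = ηC p`, `p ∈ D_C`: `T ∘ ηC = L` on `D_C`
    exact mfderiv_ne_zero_of_comp_eqOn hDCo hp (hCloc ⟨p, hp⟩) (hTd _ (Or.inr ⟨p, hp, rfl⟩))
      (fun q hq => (hTC q hq.1 hq.2).trans (hL q).symm) hL0

end Summit.SmoothPoincare4.SmoothPoincare4.Theorems.GromovRecognitionRelEnd.CrossCapLaurent
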